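import Summits.KontsevichZagierPeriods.KontsevichZagierPeriods.Theorems.RootDecompWalshStrataAffineDescent02
import Summits.KontsevichZagierPeriods.KontsevichZagierPeriods.Theorems.RootDecompWalshStrataQuadDescent02

/-!
# Quadratic descent, part 3/3: `[atomFam F σ, w(x,y)] ∈ InBaker` and `quadDescent₂_holds` over `Quadric₃`

Declarations `InBaker.quad_atomFam` (namespace `…ConicDescent`: degenerate atoms, openness and frontier of a generic
atom, the planar-sections engine with the cubic potential, edge / zero / polynomial / conic-branch section terms) and
`Quadric₃.atom_eq_atomFam`, `quadDescent₂_holds` (namespace `…ConicDescent.BallCube`) of the farm-checked gen-7 file.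
See the module docstring of `RootDecompWalshStrataQuadDescent01` (part 1) for the overview and the sources.
[KontsevichZagier2001 §1.2; BCR1998 §2.2; this node gen 7]
-/

noncomputable section

open Literature.NumberTheory.Transcendental
open MeasureTheory Set
open MvPolynomial (aeval X C)
open Literature.ModelTheory.ExponentialFields (IsSemialgebraic isSemialgebraic_univ
  isSemialgebraic_setOf_eval_pos isSemialgebraic_setOf_eval_lt isSemialgebraic_setOf_eval_le
  isSemialgebraic_setOf_eval_nonneg isSemialgebraic_setOf_eval_eq_zero
  isSemialgebraic_setOf_eval_ne_zero continuous_aeval_real tarski_seidenberg_real_holds)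

namespace Summit.KontsevichZagierPeriods.RootDecompWalshStrata.ConicDescent

namespace BallCube

/-- `(x, t)₀ = x₀` on `Fin 2` (PRIVATE copy of the AffineDescent02 rfl helper: its landed twin
`…MzvKernelInKZ.Negative.PiPolar.snoc2_zero` lives outside this chain; gate lint `dedup.landed`). [folklore] -/
@[simp] private theorem snoc_apply_zero₂ (x : Fin 1 → ℝ) (t : ℝ) :
    (Fin.snoc x t : Fin 2 → ℝ) 0 = x 0 := rfl

/-- `(x, t)₁ = t` on `Fin 2` (PRIVATE copy, same reason). [folklore] -/
@[simp] private theorem snoc_apply_one₂ (x : Fin 1 → ℝ) (t : ℝ) :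
    (Fin.snoc x t : Fin 2 → ℝ) 1 = t := rfl

end BallCube

/-! #### 27.5 Quadratic weights on the atoms of a conic family -/

/-- **QUADRATIC DESCENT ON CONIC-FAMILY ATOMS.**  For every finite family of conics `F`, sign vector
`σ` and conic weight `w`: `[atomFam F σ, w(x, y)] ∈ InBaker`.  Degenerate atoms are empty or null; a
generic atom is open with frontier in the edges of the square and the zero sets of the non-trivial
conics of the family, and the planar-sections engine with the cubic potential `Φ_w` reduces the claim to
the conic section lemma `InBaker.conic_section3` and edge terms (null / zero / polynomial).
[KontsevichZagier2001 §1.2; this node gen 7] -/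
theorem InBaker.quad_atomFam {k : ℕ} (F : Fin k → Conic) (σ : Fin k → SignType) (w : Conic)
    (r : KZ.IntegralRep 2) (hrd : r.domain = atomFam F σ)
    (hri : EqOn r.integrand (fun v => w.pxy (v 0) (v 1)) r.domain) : InBaker (KZ.of r) := by
  classical
  -- degenerate atoms: empty, or inside the zero set of a non-trivial conic of the family
  by_cases hemp : ∃ i, (∀ v : Fin 2 → ℝ, (F i).pxy (v 0) (v 1) = 0) ∧ σ i ≠ 0
  · obtain ⟨i, hi0, hσ⟩ := hemp
    refine InBaker.of_domain_eq_empty r ?_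
    rw [hrd]
    refine eq_empty_of_forall_notMem fun v hv => hσ ?_
    rw [← hv.2 i, hi0 v, sign_zero]
  by_cases hnull : ∃ i, σ i = 0 ∧ ∃ v : Fin 2 → ℝ, (F i).pxy (v 0) (v 1) ≠ 0
  · obtain ⟨i, hσ, v, hv⟩ := hnull
    refine InBaker.of_subset_zeroSet r (F i).pxyP ⟨v, by rwa [(F i).aeval_pxyP]⟩ fun x hx => ?_
    rw [(F i).aeval_pxyP]
    rw [hrd] at hx
    exact sign_eq_zero_iff.1 ((hx.2 i).trans hσ)
  -- generic atom: `σ i = 0` exactly for the identically vanishing conics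
  replace hemp : ∀ i, (∀ v : Fin 2 → ℝ, (F i).pxy (v 0) (v 1) = 0) → σ i = 0 := fun i hi =>
    by_contra fun hσ => hemp ⟨i, hi, hσ⟩
  replace hnull : ∀ i, σ i = 0 → ∀ v : Fin 2 → ℝ, (F i).pxy (v 0) (v 1) = 0 := fun i hσ v =>
    by_contra fun hv => hnull ⟨i, hσ, v, hv⟩
  have hsgn : ∀ s : SignType, s = 0 ∨ s = -1 ∨ s = 1 := fun s => by cases s <;> simp
  have hcont : ∀ i, Continuous fun v : Fin 2 → ℝ => (F i).pxy (v 0) (v 1) := fun i =>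
    (F i).continuous_pxy
  have hWI : atomFam F σ ⊆ Icc 0 1 := fun v hv => ⟨fun j => (hv.1 j).1.le, fun j => (hv.1 j).2.le⟩
  have hclI : closure (atomFam F σ) ⊆ Icc 0 1 := closure_minimal hWI isClosed_Icc
  have hWs : IsSemialgebraic ℚ (atomFam F σ) := hrd ▸ r.isSemialgebraic_domain
  have hWo : IsOpen (atomFam F σ) := by
    have hWeq : atomFam F σ = (⋂ j : Fin 2, {v : Fin 2 → ℝ | 0 < v j ∧ v j < 1}) ∩
        ⋂ i : Fin k, {v | SignType.sign ((F i).pxy (v 0) (v 1)) = σ i} := by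
      ext v; simp only [atomFam, mem_setOf_eq, mem_inter_iff, mem_iInter]
    rw [hWeq]
    refine (isOpen_iInter_of_finite fun j => ?_).inter (isOpen_iInter_of_finite fun i => ?_)
    · exact (isOpen_lt continuous_const (continuous_apply j)).inter
        (isOpen_lt (continuous_apply j) continuous_const)
    · rcases hsgn (σ i) with h | h | h
      · rw [show {v : Fin 2 → ℝ | SignType.sign ((F i).pxy (v 0) (v 1)) = σ i} = univ from
          eq_univ_of_forall fun v => by rw [mem_setOf_eq, hnull i h v, sign_zero, h]]
        exact isOpen_univ
      · simp only [h, sign_eq_neg_one_iff]; exact isOpen_lt (hcont i) continuous_const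
      · simp only [h, sign_eq_one_iff]; exact isOpen_lt continuous_const (hcont i)
  -- the frontier of a generic atom
  have hfront : ∀ z ∈ frontier (atomFam F σ), (z 0 = 0 ∨ z 0 = 1) ∨ (z 1 = 0 ∨ z 1 = 1) ∨
      ∃ i, σ i ≠ 0 ∧ (F i).pxy (z 0) (z 1) = 0 := by
    intro z hz
    rw [hWo.frontier_eq] at hz
    obtain ⟨hzc, hzW⟩ := hz
    have hzI := hclI hzc
    by_contra hcon
    simp only [not_or, not_exists, not_and] at hcon
    obtain ⟨⟨h00, h01⟩, ⟨h10, h11⟩, had⟩ := hcon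
    have hcoord : ∀ j : Fin 2, z j ≠ 0 ∧ z j ≠ 1 := Fin.forall_fin_two.2 ⟨⟨h00, h01⟩, ⟨h10, h11⟩⟩
    apply hzW
    refine ⟨fun j => ⟨lt_of_le_of_ne (hzI.1 j) (hcoord j).1.symm, lt_of_le_of_ne (hzI.2 j) (hcoord j).2⟩,
      fun i => ?_⟩
    rcases hsgn (σ i) with h | h | h
    · rw [h, hnull i h z, sign_zero]
    · have hle : (F i).pxy (z 0) (z 1) ≤ 0 :=
        closure_minimal (fun v (hv : v ∈ atomFam F σ) =>
          show v ∈ {v : Fin 2 → ℝ | (F i).pxy (v 0) (v 1) ≤ 0} from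
            (sign_eq_neg_one_iff.1 ((hv.2 i).trans h)).le)
          (isClosed_le (hcont i) continuous_const) hzc
      rw [h]
      exact sign_eq_neg_one_iff.2 (lt_of_le_of_ne hle (had i (by rw [h]; decide)))
    · have hle : 0 ≤ (F i).pxy (z 0) (z 1) :=
        closure_minimal (fun v (hv : v ∈ atomFam F σ) =>
          show v ∈ {v : Fin 2 → ℝ | 0 ≤ (F i).pxy (v 0) (v 1)} from
            (sign_eq_one_iff.1 ((hv.2 i).trans h)).le)
          (isClosed_le continuous_const (hcont i)) hzc
      rw [h]
      exact sign_eq_one_iff.2 (lt_of_le_of_ne hle (fun h0 => had i (by rw [h]; decide) h0.symm))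
  -- the engine
  refine InBaker.of_planar_sections (N := 1) hWo hWs hWI (fun z => aeval z (quadΦ w))
    (isSemialgebraicFunOn_aeval isSemialgebraic_univ _) (continuous_aeval_real _) r hrd
    (fun z hz => ?_) fun S ζ hS hζ hζc hgr r₁ hr₁d hr₁i => ?_
  · -- `∂Φ_w/∂y = w(x, y)`
    have hz' : z ∈ r.domain := by rw [hrd]; exact hz
    have h := (((hasDerivAt_id (z 1)).const_mul (w.Cx (z 0))).add
      (((hasDerivAt_id (z 1)).mul (hasDerivAt_id (z 1))).const_mul (w.Bx (z 0) / 2))).add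
      (((hasDerivAt_id (z 1)).mul ((hasDerivAt_id (z 1)).mul (hasDerivAt_id (z 1)))).const_mul
        ((w.A : ℝ) / 3))
    rw [show z (Fin.last 1) = z 1 from rfl, hri hz']
    refine (h.congr_of_eventuallyEq (Filter.Eventually.of_forall fun s => ?_)).congr_deriv ?_
    · rw [aeval_quadΦ_snoc, show Fin.init z 0 = z 0 from rfl]
      simp only [Pi.add_apply, Pi.mul_apply, id]
      ring
    · simp only [id, Pi.mul_apply, Conic.pxy]
      ring
  · -- boundary sections
    have hSI : ∀ x ∈ S, (0 ≤ x 0 ∧ x 0 ≤ 1) ∧ (0 ≤ ζ x ∧ ζ x ≤ 1) := by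
      intro x hx
      have h := hclI (frontier_subset_closure (hgr x hx))
      exact ⟨⟨by simpa using h.1 0, by simpa using h.2 0⟩, by simpa using h.1 1, by simpa using h.2 1⟩
    have hTI : ∀ T, T ⊆ S → T ⊆ Icc (0 : Fin 1 → ℝ) 1 := fun T hT x hx =>
      ⟨fun j => by rw [Subsingleton.elim j 0]; exact (hSI x (hT hx)).1.1,
        fun j => by rw [Subsingleton.elim j 0]; exact (hSI x (hT hx)).1.2⟩
    have hrS : ∀ x ∈ S, r₁.integrand x =
        w.Cx (x 0) * ζ x + w.Bx (x 0) / 2 * ζ x ^ 2 + (w.A : ℝ) / 3 * ζ x ^ 3 := by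
      intro x hx
      rw [hr₁i hx]
      beta_reduce
      rw [aeval_quadΦ_snoc]
    -- the pieces: edges `x ∈ {0,1}`, `ζ = 0`, `ζ = 1`, and the conic branches `F i (x, ζ x) = 0`
    let E : Set (Fin 1 → ℝ) := {x | aeval x (X 0 * (X 0 - 1) : MvPolynomial (Fin 1) ℚ) = 0}
    let Z0 : Set (Fin 1 → ℝ) := {x | x ∈ S ∧ ζ x = ((0 : ℚ) : ℝ)}
    let Z1 : Set (Fin 1 → ℝ) := {x | x ∈ S ∧ ζ x = ((1 : ℚ) : ℝ)}
    let Ad : Fin k → Set (Fin 1 → ℝ) := fun i =>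
      {x | x ∈ S ∧ (F i).pxy ((Fin.snoc x (ζ x) : Fin 2 → ℝ) 0) ((Fin.snoc x (ζ x) : Fin 2 → ℝ) 1) = 0
        ∧ σ i ≠ 0}
    let A : Option (Option (Option (Fin k))) → Set (Fin 1 → ℝ) := fun o =>
      o.elim E fun o' => o'.elim Z0 fun o'' => o''.elim Z1 Ad
    have hAd : ∀ i, IsSemialgebraic ℚ (Ad i) := by
      intro i
      by_cases hσ : σ i = 0
      · have : Ad i = ∅ := eq_empty_of_forall_notMem fun x hx => hx.2.2 hσ
        rw [this]; exact Literature.ModelTheory.ExponentialFields.isSemialgebraic_empty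
      · have hg : IsSemialgebraicFunOn ℚ S fun x =>
            (F i).pxy ((Fin.snoc x (ζ x) : Fin 2 → ℝ) 0) ((Fin.snoc x (ζ x) : Fin 2 → ℝ) 1) :=
          isSemialgebraicFunOn_comp_snoc (N := 1) hS
            ((isSemialgebraicFunOn_aeval isSemialgebraic_univ (F i).pxyP).congr
              fun v _ => (F i).aeval_pxyP v) hζ
        have := isSemialgebraic_sep_eq hg (isSemialgebraicFunOn_ratCast hS 0)
        convert this using 1
        ext x
        simp only [Ad, mem_setOf_eq, Rat.cast_zero, hσ, ne_eq, not_false_eq_true, and_true]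
    refine InBaker.of_cover' r₁ A ?_ ?_ ?_
    · rintro (_ | _ | _ | i)
      · exact isSemialgebraic_setOf_eval_eq_zero _
      · exact isSemialgebraic_sep_eq hζ (isSemialgebraicFunOn_ratCast hS 0)
      · exact isSemialgebraic_sep_eq hζ (isSemialgebraicFunOn_ratCast hS 1)
      · exact hAd i
    · intro x hx
      have hxS : x ∈ S := by rw [← hr₁d]; exact hx
      rcases hfront _ (hgr x hxS) with (h | h) | (h | h) | ⟨i, hσi, hi⟩
      · refine mem_iUnion.2 ⟨none, ?_⟩
        have h' : x 0 = 0 := by simpa using h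
        show aeval x (X 0 * (X 0 - 1) : MvPolynomial (Fin 1) ℚ) = 0
        simp [h']
      · refine mem_iUnion.2 ⟨none, ?_⟩
        have h' : x 0 = 1 := by simpa using h
        show aeval x (X 0 * (X 0 - 1) : MvPolynomial (Fin 1) ℚ) = 0
        simp [h']
      · exact mem_iUnion.2 ⟨some none, hxS, by simpa using h⟩
      · exact mem_iUnion.2 ⟨some (some none), hxS, by simpa using h⟩
      · exact mem_iUnion.2 ⟨some (some (some i)), hxS, hi, hσi⟩
    · rintro (_ | _ | _ | i) T hT hTr hTA
      · -- edges: null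
        exact InBaker.of_subset_zeroSet _ (X 0 * (X 0 - 1)) ⟨fun _ => 2, by norm_num⟩
          fun x hx => hTA hx
      · -- `ζ = 0`: zero integrand
        refine InBaker.of_mem_relations (KZ.of_mem_relations_of_eqOn_zero _ fun x hx => ?_)
        have hx' : x ∈ S ∧ ζ x = ((0 : ℚ) : ℝ) := hTA hx
        show r₁.integrand x = 0
        rw [hrS x hx'.1, hx'.2, Rat.cast_zero]
        ring
      · -- `ζ = 1`: polynomial integrand
        refine InBaker.of_eqOn_aeval _ (w.Cp + C (1 / 2) * w.Bp + C (w.A / 3)) fun x hx => ?_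
        have hx' : x ∈ S ∧ ζ x = ((1 : ℚ) : ℝ) := hTA hx
        show r₁.integrand x = _
        rw [hrS x hx'.1, hx'.2, Rat.cast_one]
        simp only [map_add, map_mul, MvPolynomial.aeval_C, w.aeval_Bp, w.aeval_Cp, eq_ratCast]
        push_cast
        ring
      · -- the conic branch `F i (x, ζ x) = 0`, `σ i ≠ 0`
        by_cases hT0 : T = ∅
        · exact InBaker.of_domain_eq_empty _ hT0
        obtain ⟨x₀, hx₀⟩ := nonempty_iff_ne_empty.2 hT0
        have hTS : T ⊆ S := fun x hx => (hTA hx).1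
        have hσi : σ i ≠ 0 := (hTA hx₀).2.2
        have hQ : ∃ x y : ℝ, (F i).pxy x y ≠ 0 := by
          by_contra h
          exact hσi (hemp i fun v => by_contra fun hne => h ⟨_, _, hne⟩)
        refine InBaker.conic_section3 (F i) hQ w (r₁.restrict T hT hTr) (hTI T hTS) ζ
          (hζ.mono hTS hT) (fun v hv => ?_) fun v hv => hrS v (hTS hv)
        have h := (hTA hv).2.1
        rwa [BallCube.snoc_apply_zero₂, BallCube.snoc_apply_one₂] at h

end Summit.KontsevichZagierPeriods.RootDecompWalshStrata.ConicDescent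

/-! #### 27.6 Corollary over the tree's `Quadric₃`: `QuadDescent₂` for every `K` and every conic weight -/

namespace Summit.KontsevichZagierPeriods.RootDecompWalshStrata.ConicDescent.BallCube

open Summit.KontsevichZagierPeriods.RootDecompWalshStrata.ConicDescent

/-- The adapted atoms of a quadric normal form are the sign atoms of its conic family. [this node] -/
theorem Quadric₃.atom_eq_atomFam (K : Quadric₃) (σ : Fin 5 → SignType) :
    K.atom σ = atomFam K.conic σ := by
  ext v
  simp only [Quadric₃.atom, atomFam, mem_setOf_eq, K.adapted_eq_conic]

/-- **QUADRATIC WEIGHTS ON ADAPTED ATOMS** (the third weight class of the node's typed glue: the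
`z`-length of a quadric cell with vanishing leading coefficient and constant `B` is a quadratic
polynomial in `(x, y)`):  `[atom, w(x, y)] ∈ InBaker` for every quadric normal form `K`, every sign
vector and every conic weight `w`.  Contains `AffineDescent₂` (`w` with `A_w = b₁ = c₂ = 0`).
[KontsevichZagier2001 §1.2; this node gen 7] -/
theorem quadDescent₂_holds (K : Quadric₃) (w : Conic) (σ : Fin 5 → SignType) (r : KZ.IntegralRep 2)
    (hrd : r.domain = K.atom σ) (hri : EqOn r.integrand (fun v => w.pxy (v 0) (v 1)) r.domain) :
    InBaker (KZ.of r) :=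
  InBaker.quad_atomFam K.conic σ w r (hrd.trans (K.atom_eq_atomFam σ)) hri

end Summit.KontsevichZagierPeriods.RootDecompWalshStrata.ConicDescent.BallCube
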